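import Summits.Ventures.HSemireg.Pad4TowerPermCovarianceStatic

/-!
# Cruxes ∕ BlochSeedDiscOne — THE CEILING-UNIT LAW FOR A♭_h, UNIFORM IN THE HEIGHT (anomaly lens g5, K2-iii; kernel)

HONEST FRAMING. Lens seat `plan-lens-HodgeAV-anomaly` g5 (director-hodge req-36), crux of record stmt-HodgeConjecture-18881 `BlochSeedDiscOne`
(skeleton `Lines/birth.lean` 814a6a70c14e831a UNTOUCHED). Census-neutral: a theorem about the TYPED clause of record
`Pad4TowerXresFamilies.XresA2IFires` evaluated on the ι_h-dual of an ARBITRARY configuration supported in ◇_h. Nothing here is a σ, a seed, a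
census row or a verdict on any design family; the soundness of A♭_h as a necessary condition (LEMMA A∪2I♭, pencil ×1; Binder 1 ∕ A11) is NOT used
or claimed. NOTHING HERE SAYS THAT HC ∕ HC_CM ∕ HC_AV ∕ H2 ∕ 18881 HOLDS OR FAILS (HC_CM is a displayed binder of the ladder only). No `sorry`, no
`axiom`, no `instance`, no notation, no Literature fact, no new `def … : Prop`.

WHAT. The four model certificates of A7c ∕ A9c (`AFlatCalibration.lean` ec9832fc66358c60, `AFlatTwinModelCadical.lean` 1f86f5651fded191,
`AFlatTwinModelKissat.lean` a7c7aa2c6baf551d) all fire the SAME A♭₈ instance at the ceiling diagonal unit. This file proves the reason, for every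
height at once: the five escape conjuncts of `XresA2IFires` are `∀ P ∈ C.upper, …` conditions, and on the dual `S^{ι_h}` of a ◇_h-supported `S` the
only cell that can block the instance is ONE named N-cell. In ι_h-coordinates the instance is h-free: head `Zd = [(1,−1,0)]⁴ = ι_h [(h−2)I+ℓ₁]⁴`,
partner `qd = [O ∣ (1,−1,0)³] = ι_h N[hI ∣ ((h−2)I+ℓ₁)³]`, server `Nd = [O ∣ (1,−1,0)² ∣ (2,−2,0)] = ι_h P[hI ∣ (h−2)I+ℓ₁ ∣ (h−2)I+ℓ₁ ∣ (h−4)I+2ℓ₁]`,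
indices `(σ,u,f′,v) = (0,2,3,2)`. NAMING: `ℓ₁` = the unit letter with `β = 1` (the third code's `l_1`; `Letter.l0` ∕ `step 0` of
`Pad4TowerCrossPhase`), as in `AFlatCalibration.lean` (`xC = (7,1,0) = 6I+ℓ₁`); `u = v = 2` are direction INDICES of `ray` in ι-coordinates.

**`unit_law` (kernel, all h):** for every configuration `S` with `S.InDiamond h`, if the ceiling unit `unit h = [(h−2)I+ℓ₁]⁴ ∈ S.upper`, its
b-leg `bLeg h = [hI ∣ ((h−2)I+ℓ₁)³] ∈ S.lower`, the server `server h = [hI ∣ (h−2)I+ℓ₁ ∣ (h−2)I+ℓ₁ ∣ (h−4)I+2ℓ₁] ∈ S.upper` and the N-cell with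
the server's letters is ABSENT (`server h ∉ S.lower`), then `¬ A2IMinusClosed (S.dual h)` — A♭_h fires at the unit. (Other phases ∕ factor
pairs: §5, `unit_law_perm` (any `τ ∈ S₄` re-indexing b-leg and server; the unit is `S₄`-fixed) and `unit_law_G1` (any global phase `Δ^k` on
top), by the static file's LEMMA P ∕ LEMMA T transport — v1.1; §6 = v1.2 (K2-ii): PARTNER RIGIDITY — an A♭_h instance at ANY diagonal unit
`[tI+ℓ_u]⁴` (t + 1 ≤ h) has as partner one of its four APEX b-LEGS `[tI+ℓ_u]⁴(σ ↦ (t+2)I)` (`apexBLeg_of_aFlat_fires`), so a unit with no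
apex b-leg present is A♭_h-safe as a head (`diagUnit_aFlat_safe_without_apexBLegs`); machine depth gradient at ◇₁₀ (instances ∕ min blocker
set): t = 8: 108 ∕ 1 · t = 6: 84 ∕ 16 · t = 4: 60 ∕ 45 · t = 2: 36 ∕ 88 (HOME `a9/g5-head_polluters-h10-*.txt`).) Machine companion (exhaustive over the ◇_h alphabets, h = 8, 10): HOME
`a9/g5-unit_polluters-h8.txt` cc1b62982eb215ec ∕ `-h10.txt` 2b791907289d8493 — 84 ∕ 108 potential instances at the unit, none with an empty
blocker list, exactly the 12 of this shape with a single blocker.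

v1.3 (§7–§8, after the K2 ◇₁₀ read on kit j317021 and its kernel transcripts `AFlatD10WitnessModels.lean` 14115f9c0a5afaaa): the two other FC head
classes of record get their h-uniform laws — §7 `ceil2_law`: the c = 2 ceiling diagonal `[(h−4)I+2ℓ₁]⁴` fires through its APEX LEG given the
server `[hI ∣ ((h−4)I+2ℓ₁)² ∣ (h−6)I+3ℓ₁]`, unless the UNIT LEG `N[(h−2)I+ℓ₁ ∣ ((h−4)I+2ℓ₁)³]` or the server's N-copy is present (both blockers
necessary; machine check of the maximal ◇_h world at h = 8, 10, 12 before typing); §8 `mixed_law`: the mixed cell `[((h−2)I+ℓ₁)³ ∣ (h−4)I+2ℓ₁]`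
fires through its b-leg — which is, letter for letter, the unit law's blocker N-cell (`bLegM_eq_server`, `rfl`) — given its server, unless that
server's N-copy is present; `cascade_seam` records the two-step implication for A♭_h-static supports. Row 1 ∕ row 5 of the K2 witness file are
these laws at h = 10 up to a factor permutation.

v1.4 (§9): THE CHARGE-LIFT LAW `lift_law`, uniform in the height AND in the charge `c` (symbolic `c : ℤ`; no case analysis on `c`): the lifted
head `[((h−2)I+ℓ₁)³ ∣ (h−2c)I+cℓ₁]` fires through its factor-0 b-leg `[hI ∣ ((h−2)I+ℓ₁)² ∣ (h−2c)I+cℓ₁]` given the server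
`[hI ∣ ((h−2)I+ℓ₁)² ∣ (h−2c−2)I+(c+1)ℓ₁]`, unless the server's N-copy is present; c = 1 is `unit_law`, c = 2 is `mixed_law`; the server of
step c IS the b-leg of step c + 1 (`bLegL_succ`, `rfl`). `cascade` (induction on `lift_law`): on an A♭_h-STATIC ◇_h-support containing the
unit's b-leg, if the lifted heads and servers are present as P-cells for c = 1 … n+1, then all those servers are present as N-cells. The two
factor-3 escapes are settled for symbolic c by polynomial identities + `nlinarith` (no `interval_cases`). v1.5 (§10): `lift_law_perm` ∕ `lift_law_G1` —
the `S₄ × ⟨Δ⟩`-covariant forms (every factor pair, every phase) by §5's transport. v1.6 (§11, FINAL FORM of this seat): THE TWO-FACTOR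
LAW `twoFactor_law (h c : ℤ) (p₁ p₂ : BPoint)` — the letters on the two uninvolved factors are ARBITRARY: head `[(h−2)I+ℓ₁ ∣ p₁ ∣ p₂ ∣ (h−2c)I+cℓ₁]`,
b-leg `[hI ∣ p₁ ∣ p₂ ∣ (h−2c)I+cℓ₁]`, server `[hI ∣ p₁ ∣ p₂ ∣ (h−2c−2)I+(c+1)ℓ₁]`, server's N-copy absent ⇒ A♭_h fires (the escapes only inspect
factors σ, f′); `lift_law'` re-derives §9 by specialisation; `twoFactor_law_G1` = every factor pair and phase; `bLegT_succ` (`rfl`) the seam.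

v1.7 (§12, g6 — A12, append-only): the four MIXED ceiling-unit orbits left alive by the ◇₁₀ H₁^{G₁} peel (two odd, two antipodal) are two-factor heads, so
§11 is their A♭_h law by name (`oddPlusI_law`, `oddMinusI_law`, `antimix31_law`, `antimix22_law`, all h); `head_excluded_of_chain` (+ `_G1`) packages
the law as an EXCLUSION of the head given three displayed census-side implications (head ⇒ b-leg, b-leg ⇒ server, N-copy absent), and
`oddUnits_excluded_of_chain` is the odd case: at ◇₁₀ the three hypotheses are RULE D at the head, «78 of the 79 DN-menu cells of the odd b-leg are
peel-refuted, the survivor is the server» and «the N-copy is peel-refuted» (kit j318002, instrument ×1) — i.e. H₁-peel ⊕ A♭₁₀ refutes both odd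
ceiling-unit orbits by unit propagation (modulo Binder 1), where H₁ alone needs search (kit j322459 STAGE B measures it).
-/

namespace Summit.Ventures.HSemireg.Pad4Tower

namespace AnomalyLens

namespace UnitLaw

open Finset

/-! ## §1 The instance in ι_h-coordinates (h-free) and the three original cells at height h -/

/-- `ι_h((h−2)I+ℓ₁) = (1,−1,0)`. -/
def xS : BPoint := (1, -1, 0)

/-- `ι_h((h−4)I+2ℓ₁) = (2,−2,0)`. -/
def yS : BPoint := (2, -2, 0)

/-- `ι_h(hI) = O`. -/
def oS : BPoint := (0, 0, 0)

/-- the head in dual coordinates. -/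
def Zd : MCell := mcellOf xS xS xS xS

/-- the partner in dual coordinates (dual of the b-leg). -/
def qd : MCell := mcellOf oS xS xS xS

/-- the server in dual coordinates. -/
def Nd : MCell := mcellOf oS xS xS yS

/-- the ceiling diagonal unit `[(h−2)I+ℓ₁]⁴` of height `h`. -/
def unit (h : ℤ) : MCell := mcellOf (h - 1, 1, 0) (h - 1, 1, 0) (h - 1, 1, 0) (h - 1, 1, 0)

/-- its b-leg on factor 0: `[hI ∣ ((h−2)I+ℓ₁)³]` (an N-cell of `S`). -/
def bLeg (h : ℤ) : MCell := mcellOf (h, 0, 0) (h - 1, 1, 0) (h - 1, 1, 0) (h - 1, 1, 0)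

/-- the server `[hI ∣ (h−2)I+ℓ₁ ∣ (h−2)I+ℓ₁ ∣ (h−4)I+2ℓ₁]` (a P-cell of `S`; the same letters as an N-cell are the one blocker). -/
def server (h : ℤ) : MCell := mcellOf (h, 0, 0) (h - 1, 1, 0) (h - 1, 1, 0) (h - 2, 2, 0)

theorem dual_unit (h : ℤ) : dualCell h (unit h) = Zd := by
  funext f
  fin_cases f <;> simp [unit, Zd, mcellOf, xS, dualCell, dualPt]

theorem dual_bLeg (h : ℤ) : dualCell h (bLeg h) = qd := by
  funext f
  fin_cases f <;> simp [bLeg, qd, mcellOf, xS, oS, dualCell, dualPt]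

theorem dual_server (h : ℤ) : dualCell h (server h) = Nd := by
  funext f
  fin_cases f <;> simp [server, Nd, mcellOf, xS, yS, oS, dualCell, dualPt]

theorem dual_Nd (h : ℤ) : dualCell h Nd = server h := by
  rw [← dual_server h, dualCell_dualCell]

/-! ## §2 What `◇_h` says about a dual letter -/

/-- if `ι_h x ∈ ◇_h` then, for `x = (a, b₁, b₂)` itself: `β` on an axis or zero, CAUSALITY `|b₁ − b₂| ≤ a` (from `α + c ≤ h` upstairs), and the
node parity `a + (b₁ − b₂) ≡ h (mod 2)`. -/
theorem dia_dual {h : ℤ} {x : BPoint} (hx : InDiamond h (dualPt h x)) :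
    (x.2.1 = 0 ∨ x.2.2 = 0) ∧ x.2.1 - x.2.2 ≤ x.1 ∧ x.2.2 - x.2.1 ≤ x.1 ∧ (x.1 + (x.2.1 - x.2.2)) % 2 = h % 2 := by
  simp only [InDiamond, AxisPt, absCharge, chargeOf, Prod.mk.injEq, neg_eq_zero, ne_eq] at hx
  obtain ⟨h1, h2, h3, h4⟩ := hx
  rcases abs_cases (-x.2.1 - -x.2.2) with ⟨hc, hs⟩ | ⟨hc, hs⟩
  · rw [hc] at h2 h3 h4
    refine ⟨by omega, by omega, by omega, by omega⟩
  · rw [hc] at h2 h3 h4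
    refine ⟨by omega, by omega, by omega, by omega⟩

/-- the height is EVEN as soon as the unit lies in `◇_h` (node level `h − 2`). -/
theorem even_of_unit {h : ℤ} {S : MConfig} (hD : S.InDiamond h) (hP0 : unit h ∈ S.upper) : h % 2 = 0 := by
  have hx := hD.2 _ hP0 0
  norm_num [unit, mcellOf, InDiamond, AxisPt, absCharge, chargeOf] at hx
  omega

/-! ## §3 The law -/

set_option maxHeartbeats 4000000 in
/-- **THE CEILING-UNIT LAW (all heights).** On the ι_h-dual of any ◇_h-supported configuration containing the ceiling unit, its factor-0 b-leg and
the server, and NOT containing the N-cell with the server's letters, the A2I clause of record fires at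
`(Zd; σ = 0, u = 2; qd; f′ = 3, v = 2; Nd)` — hence `S^{ι_h}` is not `A2I⁻`-closed, i.e. `S` violates A♭_h at the unit. -/
theorem unit_law (h : ℤ) (S : MConfig) (hD : S.InDiamond h) (hP0 : unit h ∈ S.upper) (hN0 : bLeg h ∈ S.lower)
    (hP1 : server h ∈ S.upper) (hX : server h ∉ S.lower) : ¬ A2IMinusClosed (S.dual h) := by
  have hev : h % 2 = 0 := even_of_unit hD hP0
  -- every dual `P`-cell is the dual of an `N`-cell of `S` inside `◇_h`
  have hdia : ∀ P ∈ (S.dual h).upper, ∀ f, InDiamond h (dualPt h (P f)) := fun P hP f =>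
    hD.1 _ (mem_dual_upper.mp hP) f
  have fires : XresA2IFires (S.dual h) Zd qd Nd 0 2 3 2 := by
    refine ⟨by decide, by decide, by decide, by decide, by decide, by decide, ?_, ?_, ?_, ?_, ?_⟩
    · -- (7) no partner of the head on factor 0 in another direction
      intro P hP w hw hU
      obtain ⟨d1, d2, d3, -⟩ := dia_dual (hdia P hP 0)
      obtain ⟨-, hlt, heq⟩ := hU
      fin_cases w <;> simp [Zd, xS, mcellOf, ray, Prod.ext_iff] at hlt heq hw <;> omega
    · -- (8) no shallower u-partner
      intro P hP hU
      obtain ⟨-, hlt, -⟩ := hU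
      simp [Zd, qd, xS, oS, mcellOf] at hlt ⊢
      omega
    · -- (9) nothing below the partner on the u-line
      intro P hP hU
      obtain ⟨d1, d2, d3, -⟩ := dia_dual (hdia P hP 0)
      obtain ⟨-, hlt, -⟩ := hU
      simp [qd, oS, mcellOf] at hlt
      omega
    · -- (10) the A1W escape on factor 3: a strictly-null-below letter inside ◇ is `O`, and the head letter IS `O + n_v`
      intro P hP hnb _
      obtain ⟨d1, d2, d3, -⟩ := dia_dual (hdia P hP 3)
      obtain ⟨hlt, -⟩ := hnb
      simp [Zd, xS, mcellOf, ray, Prod.ext_iff] at hlt ⊢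
      omega
    · -- (11) polluters of the server row: species (3b) forces `P = Nd` (absent by `hX`), species (3d) has no ◇-letter
      intro P hP hag hul
      obtain ⟨d1, d2, d3, -⟩ := dia_dual (hdia P hP 0)
      obtain ⟨e1, e2, e3, e4⟩ := dia_dual (hdia P hP 3)
      obtain ⟨hle, heq⟩ := hul
      simp [qd, oS, mcellOf, ray, Prod.ext_iff] at hle heq
      have ha0 : (P 0).1 = 0 := by omega
      have hb0 : (P 0).2.1 = 0 := by omega
      have hc0 : (P 0).2.2 = 0 := by omega
      constructor
      · rintro ⟨h1, h2, h3⟩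
        simp [Zd, Nd, xS, yS, mcellOf] at h1 h2
        have ha3 : (P 3).1 = 2 := by omega
        have hP3 : P 3 = yS := by
          rw [h3]; simp [Zd, xS, yS, mcellOf, ray, ha3]
        have hPN : P = Nd := by
          funext f
          fin_cases f
          · exact Prod.ext ha0 (Prod.ext hb0 hc0)
          · simpa [Zd, Nd, mcellOf] using hag 1 (by decide) (by decide)
          · simpa [Zd, Nd, mcellOf] using hag 2 (by decide) (by decide)
          · simpa [Nd, mcellOf] using hP3
        apply hX
        rw [← dual_Nd h, ← hPN]
        exact mem_dual_upper.mp hP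
      · rintro ⟨⟨hE1, hE2⟩, hSp⟩
        simp [Zd, Nd, xS, yS, mcellOf] at hE1 hE2 hSp
        generalize hp : P 3 = p at hE1 hE2 hSp e1 e2 e3 e4
        obtain ⟨a, b1, b2⟩ := p
        simp only at hE1 hE2 hSp e1 e2 e3 e4
        have ha : 0 ≤ a := by omega
        rcases e1 with hb | hb
        · subst hb
          have hb2l : -2 ≤ b2 := by omega
          have hb2u : b2 ≤ 2 := by omega
          interval_cases a <;> interval_cases b2 <;> omega
        · subst hb
          have hb1l : -2 ≤ b1 := by omega
          have hb1u : b1 ≤ 2 := by omega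
          interval_cases a <;> interval_cases b1 <;> omega
  intro hcl
  refine hcl Zd ?_ qd ?_ Nd ?_ 0 2 3 2 fires
  · rw [← dual_unit h]; exact dualCell_mem_dual_lower hP0
  · rw [← dual_bLeg h]; exact dualCell_mem_dual_upper hN0
  · rw [← dual_server h]; exact dualCell_mem_dual_lower hP1

/-! ## §4 Corollary at the two heights of record (the hypotheses of the four model certificates, now for EVERY support) -/

/-- `h = 8`: any ◇₈-supported `S ∋ P[6I+ℓ₁]⁴, N[8I|6I+ℓ₁|6I+ℓ₁|6I+ℓ₁], P[8I|6I+ℓ₁|6I+ℓ₁|4I+2ℓ₁]` with `N[8I|6I+ℓ₁|6I+ℓ₁|4I+2ℓ₁] ∉ S` violates A♭₈. -/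
theorem unit_law_8 (S : MConfig) (hD : S.InDiamond 8) (hP0 : unit 8 ∈ S.upper) (hN0 : bLeg 8 ∈ S.lower) (hP1 : server 8 ∈ S.upper)
    (hX : server 8 ∉ S.lower) : ¬ A2IMinusClosed (S.dual 8) :=
  unit_law 8 S hD hP0 hN0 hP1 hX

/-- `h = 10` (K2-iii): any ◇₁₀-supported `S ∋ P[8I+ℓ₁]⁴, N[10I|8I+ℓ₁|8I+ℓ₁|8I+ℓ₁], P[10I|8I+ℓ₁|8I+ℓ₁|6I+2ℓ₁]` with
`N[10I|8I+ℓ₁|8I+ℓ₁|6I+2ℓ₁] ∉ S` violates A♭₁₀. -/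
theorem unit_law_10 (S : MConfig) (hD : S.InDiamond 10) (hP0 : unit 10 ∈ S.upper) (hN0 : bLeg 10 ∈ S.lower) (hP1 : server 10 ∈ S.upper)
    (hX : server 10 ∉ S.lower) : ¬ A2IMinusClosed (S.dual 10) :=
  unit_law 10 S hD hP0 hN0 hP1 hX


/-! ## §5 `G₁`-covariant forms: every factor pair `(σ, f′)` and every phase (the static file's LEMMA P ∕ LEMMA T machinery) -/

/-- the unit is fixed by every factor permutation. -/
theorem unit_perm (h : ℤ) (τ : Equiv.Perm (Fin 4)) : (unit h).perm τ = unit h := by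
  have hu : ∀ g : Fin 4, unit h g = (h - 1, 1, 0) := by
    intro g; fin_cases g <;> rfl
  funext f
  rw [MCell.perm_apply, hu, hu]

/-- **the law for every factor pair**: b-leg on factor `τ 0`… precisely, with the b-leg and the server re-indexed by any `τ ∈ S₄` (the unit is
`S₄`-fixed), same conclusion. [`unit_law` on `S.permImage τ⁻¹`, transported by `dual_permImage` + `a2iMinusClosed_permImage`.] -/
theorem unit_law_perm (h : ℤ) (τ : Equiv.Perm (Fin 4)) (S : MConfig) (hD : S.InDiamond h) (hP0 : unit h ∈ S.upper)
    (hN0 : (bLeg h).perm τ ∈ S.lower) (hP1 : (server h).perm τ ∈ S.upper) (hX : (server h).perm τ ∉ S.lower) :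
    ¬ A2IMinusClosed (S.dual h) := by
  have key := unit_law h (S.permImage τ⁻¹) ((inDiamond_permImage_iff τ⁻¹ S h).mpr hD)
    ((mem_permImage_upper _ _).mpr ⟨unit h, hP0, unit_perm h τ⁻¹⟩)
    ((mem_permImage_lower _ _).mpr ⟨_, hN0, MCell.perm_perm_inv τ _⟩)
    ((mem_permImage_upper _ _).mpr ⟨_, hP1, MCell.perm_perm_inv τ _⟩)
    (by
      intro hmem
      obtain ⟨Z, hZ, hZe⟩ := (mem_permImage_lower _ _).mp hmem
      apply hX
      have hZ' : Z = (server h).perm τ := by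
        rw [← hZe, MCell.perm_inv_perm]
      rw [← hZ']
      exact hZ)
  rwa [dual_permImage, a2iMinusClosed_permImage] at key

/-- the height-`h` dual commutes with a factor rotation, pointwise (LEMMA T's `dualPt_phasePt` is `h = 0`; as in `AFlatCovariance.lean`). -/
theorem dualPt_phasePt_height (h : ℤ) (n : Fin 4) (x : BPoint) : dualPt h (phasePt n x) = phasePt n (dualPt h x) := by
  obtain ⟨a, b, c⟩ := x; fin_cases n <;> simp [dualPt, phasePt]

/-- … on cells … -/
theorem dualCell_phase_height (h : ℤ) (η : PVec) (Z : MCell) : dualCell h (Z.phase η) = (dualCell h Z).phase η := by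
  funext f; simp [dualCell, MCell.phase, dualPt_phasePt_height]

/-- … and on configurations. -/
theorem dual_phaseImage_height (h : ℤ) (η : PVec) (C : MConfig) : (C.phaseImage η).dual h = (C.dual h).phaseImage η := by
  simp only [MConfig.dual, MConfig.phaseImage, Finset.image_image, MConfig.mk.injEq]
  constructor <;> (congr 1; funext X; exact dualCell_phase_height h η X)

/-- undoing a global rotation. -/
theorem phase_cvec_neg_cvec (k : Fin 4) (X : MCell) : (X.phase (cvec k)).phase (cvec (-k)) = X := by
  rw [← MCell.phase_add]
  have h0 : cvec (-k) + cvec k = (0 : PVec) := by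
    funext f; simp [cvec]
  rw [h0, MCell.phase_zero]

theorem phase_neg_cvec_cvec (k : Fin 4) (X : MCell) : (X.phase (cvec (-k))).phase (cvec k) = X := by
  simpa using phase_cvec_neg_cvec (-k) X

/-- **the law for every phase and every factor pair** (`G₁ = ⟨Δ⟩ × S₄`-covariant form): the unit `[(h−2)I+ℓ_{i^k}]⁴`, its re-indexed b-leg and
server rotated by the global phase `Δ^k`, the rotated server's N-copy absent ⇒ A♭_h fires. [`unit_law_perm` on `S.phaseImage (cvec (−k))`,
transported by `dual_phaseImage_height` + LEMMA T `a2iMinusClosed_phaseImage`.] -/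
theorem unit_law_G1 (h : ℤ) (k : Fin 4) (τ : Equiv.Perm (Fin 4)) (S : MConfig) (hD : S.InDiamond h)
    (hP0 : (unit h).phase (cvec k) ∈ S.upper) (hN0 : ((bLeg h).perm τ).phase (cvec k) ∈ S.lower)
    (hP1 : ((server h).perm τ).phase (cvec k) ∈ S.upper) (hX : ((server h).perm τ).phase (cvec k) ∉ S.lower) :
    ¬ A2IMinusClosed (S.dual h) := by
  have key := unit_law_perm h τ (S.phaseImage (cvec (-k))) ((inDiamond_phaseImage (cvec (-k)) S h).mpr hD)
    (mem_phaseImage_upper.mpr ⟨_, hP0, phase_cvec_neg_cvec k _⟩)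
    (mem_phaseImage_lower.mpr ⟨_, hN0, phase_cvec_neg_cvec k _⟩)
    (mem_phaseImage_upper.mpr ⟨_, hP1, phase_cvec_neg_cvec k _⟩)
    (by
      intro hmem
      obtain ⟨Z, hZ, hZe⟩ := mem_phaseImage_lower.mp hmem
      apply hX
      have hZ' : Z = ((server h).perm τ).phase (cvec k) := by
        rw [← hZe, phase_neg_cvec_cvec]
      rw [← hZ']
      exact hZ)
  rwa [dual_phaseImage_height, a2iMinusClosed_phaseImage] at key


/-! ## §6 PARTNER RIGIDITY at diagonal units (K2-ii): A♭_h can fire at `[tI+ℓ_u]⁴` only through an APEX b-LEG `N[(t+2)I ∣ (tI+ℓ_u)³]` -/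

/-- **partner rigidity** (no support hypothesis at all): if the A2I clause fires with head letter `Z_σ` of non-negative height and charge
`cabs = 1` (in the coordinates the clause is evaluated in), then the GUARD forces depth `1` along the encoder ray, so the partner is `Z` with its
`σ`-letter replaced by the apex `((Z_σ).α − 1)·I`. -/
theorem partner_rigidity {C : MConfig} {Z q N : MCell} {σ u f v : Fin 4} (hα : 0 ≤ (Z σ).1) (hc : cabs (Z σ) = 1)
    (hF : XresA2IFires C Z q N σ u f v) : q = Function.update Z σ ((Z σ).1 - 1, 0, 0) := by
  obtain ⟨-, hE, ⟨hag, hlt, hray⟩, hg, -⟩ := hF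
  dsimp only [EncDir] at hE
  rw [hc] at hE hg
  have hd : (q σ).1 = (Z σ).1 - 1 := by
    have := hg hα
    omega
  have hqσ : q σ = ((Z σ).1 - 1, 0, 0) := by
    rcases hE with ⟨-, hE⟩ | ⟨hneg, -⟩
    · rw [hd] at hray
      generalize hz : Z σ = z at hE hray hd
      generalize hw : q σ = w at hray hd
      obtain ⟨a, b1, b2⟩ := z
      obtain ⟨a', b1', b2'⟩ := w
      fin_cases u <;> simp [ray, Prod.ext_iff] at hE hray hd ⊢ <;> omega
    · omega
  funext g
  by_cases hgs : g = σ
  · subst hgs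
    simp [hqσ]
  · rw [Function.update_of_ne hgs]
    exact hag g hgs

/-- the diagonal unit of node level `t`, charge `1`, phase `ℓ_{i^k}`: `[tI+ℓ_{i^k}]⁴` (letter `diamondLetter t 1 k = t·I + ℓ_{i^k}`). -/
def diagUnitT (t : ℤ) (k : Fin 4) : MCell := fun _ => diamondLetter t 1 k

/-- its dual letter has height `h − t − 1` and charge `1`. -/
theorem dual_diagUnitT_letter (h t : ℤ) (k : Fin 4) (g : Fin 4) :
    (dualCell h (diagUnitT t k) g).1 = h - t - 1 ∧ cabs (dualCell h (diagUnitT t k) g) = 1 := by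
  fin_cases k <;> simp [diagUnitT, diamondLetter, ray, cabs] <;> ring

/-- `dualCell` commutes with replacing one letter. -/
theorem dualCell_update (h : ℤ) (Z : MCell) (σ : Fin 4) (y : BPoint) :
    dualCell h (Function.update Z σ y) = Function.update (dualCell h Z) σ (dualPt h y) := by
  funext g
  by_cases hg : g = σ
  · subst hg; simp [dualCell]
  · simp [dualCell, Function.update_of_ne hg]

/-- **A♭_h AT A DIAGONAL UNIT NEEDS AN APEX b-LEG** (all `h`, all node levels `t ≤ h − 1`, all phases, all factors): if an A♭_h instance
fires on `S^{ι_h}` with head the dual of `[tI+ℓ_{i^k}]⁴` and partner `q` (a dual `P`-cell, i.e. `ι_h` of an `N`-cell of `S`), then that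
`N`-cell is the apex b-leg `[tI+ℓ_{i^k}]⁴ (σ ↦ (t+2)I)`. [`partner_rigidity` + `dualCell_update`; the machine tables
`a9/g5-head_polluters-h10-*.txt` list, per `t`, the servers and blocker sets that then decide the firing.] -/
theorem apexBLeg_of_aFlat_fires (h t : ℤ) (hth : t + 1 ≤ h) (k : Fin 4) {S : MConfig} {q N : MCell} {σ u f v : Fin 4}
    (hq : q ∈ (S.dual h).upper) (hF : XresA2IFires (S.dual h) (dualCell h (diagUnitT t k)) q N σ u f v) :
    Function.update (diagUnitT t k) σ (t + 2, 0, 0) ∈ S.lower := by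
  obtain ⟨hα', hc⟩ := dual_diagUnitT_letter h t k σ
  have hrig := partner_rigidity (by rw [hα']; omega) hc hF
  have hq' : dualCell h q ∈ S.lower := mem_dual_upper.mp hq
  rw [hrig, dualCell_update, dualCell_dualCell, hα'] at hq'
  convert hq' using 2
  simp [dualPt]; ring

/-- contrapositive, as the K2-ii reading uses it: **a diagonal unit none of whose four apex b-legs is present is A♭_h-SAFE as a head** — no
instance of the clause of record fires at it on `S^{ι_h}`, whatever else `S` contains. -/
theorem diagUnit_aFlat_safe_without_apexBLegs (h t : ℤ) (hth : t + 1 ≤ h) (k : Fin 4) (S : MConfig)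
    (hno : ∀ σ : Fin 4, Function.update (diagUnitT t k) σ (t + 2, 0, 0) ∉ S.lower) :
    ∀ q ∈ (S.dual h).upper, ∀ N ∈ (S.dual h).lower, ∀ σ u f v : Fin 4,
      ¬ XresA2IFires (S.dual h) (dualCell h (diagUnitT t k)) q N σ u f v :=
  fun _ hq _ _ σ _ _ _ hF => hno σ (apexBLeg_of_aFlat_fires h t hth k hq hF)

/-! ## §7 THE c = 2 CEILING-LINE LAW (K2-ii, row 1 of kit j317021): A♭_h fires at `[(h−4)I+2ℓ₁]⁴` through an APEX LEG, given its server, unless the unit-depth partner or the server's N-copy is present -/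

/-- `ι_h((h−6)I+3ℓ₁) = (3,−3,0)`. -/
def zS : BPoint := (3, -3, 0)

/-- the c = 2 head `[(h−4)I+2ℓ₁]⁴` in dual coordinates. -/
def Zd2 : MCell := mcellOf yS yS yS yS

/-- its partner = the dual of the APEX LEG (depth 2 = c: the guard is met with equality). -/
def qd2 : MCell := mcellOf oS yS yS yS

/-- the server in dual coordinates (factor 3 lifted from `2ℓ` to `3ℓ`). -/
def Nd2 : MCell := mcellOf oS yS yS zS

/-- the unit-depth partner (dual of the UNIT LEG `N[(h−2)I+ℓ₁ ∣ ((h−4)I+2ℓ₁)³]`): the escape `inter` requires it ABSENT. -/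
def Id2 : MCell := mcellOf xS yS yS yS

/-- the c = 2 ceiling-line diagonal `[(h−4)I+2ℓ₁]⁴` of height `h` (`P[6I+2ℓ₁]⁴` at h = 10). -/
def head2 (h : ℤ) : MCell := mcellOf (h - 2, 2, 0) (h - 2, 2, 0) (h - 2, 2, 0) (h - 2, 2, 0)

/-- its APEX LEG on factor 0: `[hI ∣ ((h−4)I+2ℓ₁)³]`. -/
def apexLeg2 (h : ℤ) : MCell := mcellOf (h, 0, 0) (h - 2, 2, 0) (h - 2, 2, 0) (h - 2, 2, 0)

/-- its UNIT LEG on factor 0: `[(h−2)I+ℓ₁ ∣ ((h−4)I+2ℓ₁)³]` (the blocker of species `inter`). -/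
def unitLeg2 (h : ℤ) : MCell := mcellOf (h - 1, 1, 0) (h - 2, 2, 0) (h - 2, 2, 0) (h - 2, 2, 0)

/-- the server `[hI ∣ (h−4)I+2ℓ₁ ∣ (h−4)I+2ℓ₁ ∣ (h−6)I+3ℓ₁]` (`P[10I|6I+2ℓ₁|6I+2ℓ₁|4I+3ℓ₁]` at h = 10; its letters as an N-cell are the second blocker). -/
def server2 (h : ℤ) : MCell := mcellOf (h, 0, 0) (h - 2, 2, 0) (h - 2, 2, 0) (h - 3, 3, 0)

theorem dual_head2 (h : ℤ) : dualCell h (head2 h) = Zd2 := by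
  funext f
  fin_cases f <;> simp [head2, Zd2, mcellOf, yS, dualCell, dualPt]

theorem dual_apexLeg2 (h : ℤ) : dualCell h (apexLeg2 h) = qd2 := by
  funext f
  fin_cases f <;> simp [apexLeg2, qd2, mcellOf, yS, oS, dualCell, dualPt]

theorem dual_unitLeg2 (h : ℤ) : dualCell h (unitLeg2 h) = Id2 := by
  funext f
  fin_cases f <;> simp [unitLeg2, Id2, mcellOf, xS, yS, dualCell, dualPt]

theorem dual_server2 (h : ℤ) : dualCell h (server2 h) = Nd2 := by
  funext f
  fin_cases f <;> simp [server2, Nd2, mcellOf, yS, zS, oS, dualCell, dualPt]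

theorem dual_Nd2 (h : ℤ) : dualCell h Nd2 = server2 h := by
  rw [← dual_server2 h, dualCell_dualCell]

theorem dual_Id2 (h : ℤ) : dualCell h Id2 = unitLeg2 h := by
  rw [← dual_unitLeg2 h, dualCell_dualCell]

/-- the height is EVEN as soon as the c = 2 head lies in `◇_h` (node level `h − 4`). -/
theorem even_of_head2 {h : ℤ} {S : MConfig} (hD : S.InDiamond h) (hP0 : head2 h ∈ S.upper) : h % 2 = 0 := by
  have hx := hD.2 _ hP0 0
  norm_num [head2, mcellOf, InDiamond, AxisPt, absCharge, chargeOf] at hx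
  omega

set_option maxHeartbeats 8000000 in
/-- **THE c = 2 CEILING-LINE LAW (all heights).** On the ι_h-dual of any ◇_h-supported configuration containing the c = 2 ceiling diagonal
`[(h−4)I+2ℓ₁]⁴`, its factor-0 APEX LEG and the server, and containing NEITHER the factor-0 unit leg NOR the N-cell with the server's letters,
the A2I clause of record fires at `(Zd2; σ = 0, u = 2; qd2; f′ = 3, v = 2; Nd2)` — `S` violates A♭_h at the c = 2 diagonal. Both absences are
necessary (the clause's escapes `inter` ∕ species (3b) name exactly these cells). The certified row-1 instance of `AFlatD10WitnessModels.lean`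
(14115f9c0a5afaaa, `fcd_not_aFlat10`) is this law at h = 10 up to the factor permutation (1 3). -/
theorem ceil2_law (h : ℤ) (S : MConfig) (hD : S.InDiamond h) (hP0 : head2 h ∈ S.upper) (hN0 : apexLeg2 h ∈ S.lower)
    (hX1 : unitLeg2 h ∉ S.lower) (hP1 : server2 h ∈ S.upper) (hX : server2 h ∉ S.lower) : ¬ A2IMinusClosed (S.dual h) := by
  have hev : h % 2 = 0 := even_of_head2 hD hP0
  have hdia : ∀ P ∈ (S.dual h).upper, ∀ f, InDiamond h (dualPt h (P f)) := fun P hP f =>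
    hD.1 _ (mem_dual_upper.mp hP) f
  have fires : XresA2IFires (S.dual h) Zd2 qd2 Nd2 0 2 3 2 := by
    refine ⟨by decide, by decide, by decide, by decide, by decide, by decide, ?_, ?_, ?_, ?_, ?_⟩
    · -- (7) no partner of the head on factor 0 in another direction (such a letter leaves ◇)
      intro P hP w hw hU
      obtain ⟨d1, d2, d3, -⟩ := dia_dual (hdia P hP 0)
      obtain ⟨-, hlt, heq⟩ := hU
      fin_cases w <;> simp [Zd2, yS, mcellOf, ray, Prod.ext_iff] at hlt heq hw <;> omega
    · -- (8) a shallower u-partner is the unit-depth partner `Id2`, absent by `hX1`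
      intro P hP hU
      obtain ⟨d1, d2, d3, -⟩ := dia_dual (hdia P hP 0)
      obtain ⟨hag, hlt, heq⟩ := hU
      simp [Zd2, qd2, yS, oS, mcellOf, ray, Prod.ext_iff] at hlt heq ⊢
      by_contra hgt
      have ha : (P 0).1 = 1 := by omega
      have hb : (P 0).2.1 = -1 := by omega
      have hc : (P 0).2.2 = 0 := by omega
      have hPI : P = Id2 := by
        funext f
        fin_cases f
        · exact Prod.ext ha (Prod.ext hb hc)
        · simpa [Zd2, Id2, mcellOf] using hag 1 (by decide)
        · simpa [Zd2, Id2, mcellOf] using hag 2 (by decide)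
        · simpa [Zd2, Id2, mcellOf] using hag 3 (by decide)
      apply hX1
      rw [← dual_Id2 h, ← hPI]
      exact mem_dual_upper.mp hP
    · -- (9) nothing below the partner on the u-line
      intro P hP hU
      obtain ⟨d1, d2, d3, -⟩ := dia_dual (hdia P hP 0)
      obtain ⟨-, hlt, -⟩ := hU
      simp [qd2, oS, mcellOf] at hlt
      omega
    · -- (10) the A1W escape on factor 3: the strictly-null-below ◇-letters of `(2,−2,0)` are `(1,−1,0)` and `O`, both on its v-ray
      intro P hP hnb _
      obtain ⟨d1, d2, d3, -⟩ := dia_dual (hdia P hP 3)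
      obtain ⟨hlt, hnull⟩ := hnb
      simp [Zd2, yS, mcellOf, ray, Prod.ext_iff] at hlt hnull ⊢
      generalize hp : P 3 = p at hlt hnull d1 d2 d3
      obtain ⟨a, b1, b2⟩ := p
      simp only at hlt hnull d1 d2 d3 ⊢
      have ha : 0 ≤ a := by omega
      rcases d1 with hb | hb
      · subst hb
        have hb2l : -2 ≤ b2 := by omega
        have hb2u : b2 ≤ 2 := by omega
        interval_cases a <;> interval_cases b2 <;> omega
      · subst hb
        have hb1l : -2 ≤ b1 := by omega
        have hb1u : b1 ≤ 2 := by omega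
        interval_cases a <;> interval_cases b1 <;> omega
    · -- (11) polluters of the server row: species (3b) forces `P = Nd2` (absent by `hX`), species (3d) has no ◇-letter
      intro P hP hag hul
      obtain ⟨d1, d2, d3, -⟩ := dia_dual (hdia P hP 0)
      obtain ⟨e1, e2, e3, e4⟩ := dia_dual (hdia P hP 3)
      obtain ⟨hle, heq⟩ := hul
      simp [qd2, oS, mcellOf, ray, Prod.ext_iff] at hle heq
      have ha0 : (P 0).1 = 0 := by omega
      have hb0 : (P 0).2.1 = 0 := by omega
      have hc0 : (P 0).2.2 = 0 := by omega
      constructor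
      · rintro ⟨h1, h2, h3⟩
        simp [Zd2, Nd2, yS, zS, mcellOf] at h1 h2
        have ha3 : (P 3).1 = 3 := by omega
        have hP3 : P 3 = zS := by
          rw [h3]; simp [Zd2, yS, zS, mcellOf, ray, ha3]
        have hPN : P = Nd2 := by
          funext f
          fin_cases f
          · exact Prod.ext ha0 (Prod.ext hb0 hc0)
          · simpa [Zd2, Nd2, mcellOf] using hag 1 (by decide) (by decide)
          · simpa [Zd2, Nd2, mcellOf] using hag 2 (by decide) (by decide)
          · simpa [Nd2, mcellOf] using hP3
        apply hX
        rw [← dual_Nd2 h, ← hPN]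
        exact mem_dual_upper.mp hP
      · rintro ⟨⟨hE1, hE2⟩, hSp⟩
        simp [Zd2, Nd2, yS, zS, mcellOf] at hE1 hE2 hSp
        generalize hp : P 3 = p at hE1 hE2 hSp e1 e2 e3 e4
        obtain ⟨a, b1, b2⟩ := p
        simp only at hE1 hE2 hSp e1 e2 e3 e4
        have ha : 0 ≤ a := by omega
        have hau : a ≤ 3 := by omega
        rcases e1 with hb | hb
        · subst hb
          have hb2l : -3 ≤ b2 := by omega
          have hb2u : b2 ≤ 3 := by omega
          interval_cases a <;> interval_cases b2 <;> omega
        · subst hb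
          have hb1l : -3 ≤ b1 := by omega
          have hb1u : b1 ≤ 3 := by omega
          interval_cases a <;> interval_cases b1 <;> omega
  intro hcl
  refine hcl Zd2 ?_ qd2 ?_ Nd2 ?_ 0 2 3 2 fires
  · rw [← dual_head2 h]; exact dualCell_mem_dual_lower hP0
  · rw [← dual_apexLeg2 h]; exact dualCell_mem_dual_upper hN0
  · rw [← dual_server2 h]; exact dualCell_mem_dual_lower hP1

/-- `h = 10` (K2-ii row 1): any ◇₁₀-supported `S ∋ P[6I+2ℓ₁]⁴, N[10I|(6I+2ℓ₁)³], P[10I|6I+2ℓ₁|6I+2ℓ₁|4I+3ℓ₁]` with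
`N[8I+ℓ₁|(6I+2ℓ₁)³] ∉ S` and `N[10I|6I+2ℓ₁|6I+2ℓ₁|4I+3ℓ₁] ∉ S` violates A♭₁₀. -/
theorem ceil2_law_10 (S : MConfig) (hD : S.InDiamond 10) (hP0 : head2 10 ∈ S.upper) (hN0 : apexLeg2 10 ∈ S.lower)
    (hX1 : unitLeg2 10 ∉ S.lower) (hP1 : server2 10 ∈ S.upper) (hX : server2 10 ∉ S.lower) : ¬ A2IMinusClosed (S.dual 10) :=
  ceil2_law 10 S hD hP0 hN0 hX1 hP1 hX


/-! ## §8 THE MIXED CEILING LAW (K2-ii, row 5 of kit j317021): A♭_h fires at `[((h−2)I+ℓ₁)³ ∣ (h−4)I+2ℓ₁]` through its b-leg, whose letters are the UNIT LAW'S BLOCKER -/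

/-- the mixed head `[((h−2)I+ℓ₁)³ ∣ (h−4)I+2ℓ₁]` in dual coordinates (the unit with factor 3 lifted by one charge). -/
def ZdM : MCell := mcellOf xS xS xS yS

/-- its partner = the dual of the b-leg `[hI ∣ ((h−2)I+ℓ₁)² ∣ (h−4)I+2ℓ₁]` — the letters of the unit law's server, as an N-cell. -/
def qdM : MCell := mcellOf oS xS xS yS

/-- the server in dual coordinates. -/
def NdM : MCell := mcellOf oS xS xS zS

/-- the mixed ceiling cell `[((h−2)I+ℓ₁)³ ∣ (h−4)I+2ℓ₁]` (`P[8I+ℓ₁|8I+ℓ₁|8I+ℓ₁|6I+2ℓ₁]` at h = 10, the row-5 FC orbit up to S₄). -/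
def headM (h : ℤ) : MCell := mcellOf (h - 1, 1, 0) (h - 1, 1, 0) (h - 1, 1, 0) (h - 2, 2, 0)

/-- its b-leg on factor 0: `[hI ∣ ((h−2)I+ℓ₁)² ∣ (h−4)I+2ℓ₁]` = the letters of `server h` (§1) as an N-cell. -/
def bLegM (h : ℤ) : MCell := mcellOf (h, 0, 0) (h - 1, 1, 0) (h - 1, 1, 0) (h - 2, 2, 0)

/-- the server `[hI ∣ (h−2)I+ℓ₁ ∣ (h−2)I+ℓ₁ ∣ (h−6)I+3ℓ₁]` (`P[10I|8I+ℓ₁|8I+ℓ₁|4I+3ℓ₁]` at h = 10). -/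
def serverM (h : ℤ) : MCell := mcellOf (h, 0, 0) (h - 1, 1, 0) (h - 1, 1, 0) (h - 3, 3, 0)

/-- the mixed head's b-leg IS the unit law's server read as an N-cell. -/
theorem bLegM_eq_server (h : ℤ) : bLegM h = server h := rfl

theorem dual_headM (h : ℤ) : dualCell h (headM h) = ZdM := by
  funext f
  fin_cases f <;> simp [headM, ZdM, mcellOf, xS, yS, dualCell, dualPt]

theorem dual_bLegM (h : ℤ) : dualCell h (bLegM h) = qdM := by
  funext f
  fin_cases f <;> simp [bLegM, qdM, mcellOf, xS, yS, oS, dualCell, dualPt]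

theorem dual_serverM (h : ℤ) : dualCell h (serverM h) = NdM := by
  funext f
  fin_cases f <;> simp [serverM, NdM, mcellOf, xS, zS, oS, dualCell, dualPt]

theorem dual_NdM (h : ℤ) : dualCell h NdM = serverM h := by
  rw [← dual_serverM h, dualCell_dualCell]

/-- the height is EVEN as soon as the mixed head lies in `◇_h`. -/
theorem even_of_headM {h : ℤ} {S : MConfig} (hD : S.InDiamond h) (hP0 : headM h ∈ S.upper) : h % 2 = 0 := by
  have hx := hD.2 _ hP0 0
  norm_num [headM, mcellOf, InDiamond, AxisPt, absCharge, chargeOf] at hx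
  omega

set_option maxHeartbeats 8000000 in
/-- **THE MIXED CEILING LAW (all heights).** On the ι_h-dual of any ◇_h-supported configuration containing the mixed ceiling cell
`[((h−2)I+ℓ₁)³ ∣ (h−4)I+2ℓ₁]`, its factor-0 b-leg and the server, and NOT containing the N-cell with the server's letters, the A2I clause of record
fires at `(ZdM; σ = 0, u = 2; qdM; f′ = 3, v = 2; NdM)`. The certified row-5 instance of `AFlatD10WitnessModels.lean` (14115f9c0a5afaaa,
`fcn_not_aFlat10`) is this law at h = 10 up to a factor permutation. Note the cascade: the b-leg required here is, letter for letter, the N-cell whose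
ABSENCE the unit law (§3) requires. -/
theorem mixed_law (h : ℤ) (S : MConfig) (hD : S.InDiamond h) (hP0 : headM h ∈ S.upper) (hN0 : bLegM h ∈ S.lower)
    (hP1 : serverM h ∈ S.upper) (hX : serverM h ∉ S.lower) : ¬ A2IMinusClosed (S.dual h) := by
  have hev : h % 2 = 0 := even_of_headM hD hP0
  have hdia : ∀ P ∈ (S.dual h).upper, ∀ f, InDiamond h (dualPt h (P f)) := fun P hP f =>
    hD.1 _ (mem_dual_upper.mp hP) f
  have fires : XresA2IFires (S.dual h) ZdM qdM NdM 0 2 3 2 := by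
    refine ⟨by decide, by decide, by decide, by decide, by decide, by decide, ?_, ?_, ?_, ?_, ?_⟩
    · -- (7) no partner of the head on factor 0 in another direction
      intro P hP w hw hU
      obtain ⟨d1, d2, d3, -⟩ := dia_dual (hdia P hP 0)
      obtain ⟨-, hlt, heq⟩ := hU
      fin_cases w <;> simp [ZdM, xS, mcellOf, ray, Prod.ext_iff] at hlt heq hw <;> omega
    · -- (8) no shallower u-partner (the partner is at depth 1)
      intro P hP hU
      obtain ⟨-, hlt, -⟩ := hU
      simp [ZdM, qdM, xS, oS, mcellOf] at hlt ⊢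
      omega
    · -- (9) nothing below the partner on the u-line
      intro P hP hU
      obtain ⟨d1, d2, d3, -⟩ := dia_dual (hdia P hP 0)
      obtain ⟨-, hlt, -⟩ := hU
      simp [qdM, oS, mcellOf] at hlt
      omega
    · -- (10) the A1W escape on factor 3 (letter `(2,−2,0)`): its strictly-null-below ◇-letters lie on its v-ray
      intro P hP hnb _
      obtain ⟨d1, d2, d3, -⟩ := dia_dual (hdia P hP 3)
      obtain ⟨hlt, hnull⟩ := hnb
      simp [ZdM, yS, mcellOf, ray, Prod.ext_iff] at hlt hnull ⊢
      generalize hp : P 3 = p at hlt hnull d1 d2 d3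
      obtain ⟨a, b1, b2⟩ := p
      simp only at hlt hnull d1 d2 d3 ⊢
      have ha : 0 ≤ a := by omega
      rcases d1 with hb | hb
      · subst hb
        have hb2l : -2 ≤ b2 := by omega
        have hb2u : b2 ≤ 2 := by omega
        interval_cases a <;> interval_cases b2 <;> omega
      · subst hb
        have hb1l : -2 ≤ b1 := by omega
        have hb1u : b1 ≤ 2 := by omega
        interval_cases a <;> interval_cases b1 <;> omega
    · -- (11) polluters of the server row: species (3b) forces `P = NdM` (absent by `hX`), species (3d) has no ◇-letter
      intro P hP hag hul
      obtain ⟨d1, d2, d3, -⟩ := dia_dual (hdia P hP 0)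
      obtain ⟨e1, e2, e3, e4⟩ := dia_dual (hdia P hP 3)
      obtain ⟨hle, heq⟩ := hul
      simp [qdM, oS, mcellOf, ray, Prod.ext_iff] at hle heq
      have ha0 : (P 0).1 = 0 := by omega
      have hb0 : (P 0).2.1 = 0 := by omega
      have hc0 : (P 0).2.2 = 0 := by omega
      constructor
      · rintro ⟨h1, h2, h3⟩
        simp [ZdM, NdM, yS, zS, mcellOf] at h1 h2
        have ha3 : (P 3).1 = 3 := by omega
        have hP3 : P 3 = zS := by
          rw [h3]; simp [ZdM, yS, zS, mcellOf, ray, ha3]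
        have hPN : P = NdM := by
          funext f
          fin_cases f
          · exact Prod.ext ha0 (Prod.ext hb0 hc0)
          · simpa [ZdM, NdM, mcellOf] using hag 1 (by decide) (by decide)
          · simpa [ZdM, NdM, mcellOf] using hag 2 (by decide) (by decide)
          · simpa [NdM, mcellOf] using hP3
        apply hX
        rw [← dual_NdM h, ← hPN]
        exact mem_dual_upper.mp hP
      · rintro ⟨⟨hE1, hE2⟩, hSp⟩
        simp [ZdM, NdM, yS, zS, mcellOf] at hE1 hE2 hSp
        generalize hp : P 3 = p at hE1 hE2 hSp e1 e2 e3 e4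
        obtain ⟨a, b1, b2⟩ := p
        simp only at hE1 hE2 hSp e1 e2 e3 e4
        have ha : 0 ≤ a := by omega
        have hau : a ≤ 3 := by omega
        rcases e1 with hb | hb
        · subst hb
          have hb2l : -3 ≤ b2 := by omega
          have hb2u : b2 ≤ 3 := by omega
          interval_cases a <;> interval_cases b2 <;> omega
        · subst hb
          have hb1l : -3 ≤ b1 := by omega
          have hb1u : b1 ≤ 3 := by omega
          interval_cases a <;> interval_cases b1 <;> omega
  intro hcl
  refine hcl ZdM ?_ qdM ?_ NdM ?_ 0 2 3 2 fires
  · rw [← dual_headM h]; exact dualCell_mem_dual_lower hP0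
  · rw [← dual_bLegM h]; exact dualCell_mem_dual_upper hN0
  · rw [← dual_serverM h]; exact dualCell_mem_dual_lower hP1

/-- `h = 10` (K2-ii row 5): any ◇₁₀-supported `S ∋ P[8I+ℓ₁|8I+ℓ₁|8I+ℓ₁|6I+2ℓ₁], N[10I|8I+ℓ₁|8I+ℓ₁|6I+2ℓ₁], P[10I|8I+ℓ₁|8I+ℓ₁|4I+3ℓ₁]` with
`N[10I|8I+ℓ₁|8I+ℓ₁|4I+3ℓ₁] ∉ S` violates A♭₁₀. -/
theorem mixed_law_10 (S : MConfig) (hD : S.InDiamond 10) (hP0 : headM 10 ∈ S.upper) (hN0 : bLegM 10 ∈ S.lower)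
    (hP1 : serverM 10 ∈ S.upper) (hX : serverM 10 ∉ S.lower) : ¬ A2IMinusClosed (S.dual 10) :=
  mixed_law 10 S hD hP0 hN0 hP1 hX

/-- **THE CASCADE SEAM (unit law ⇄ mixed law).** If a ◇_h-support is A♭_h-static and carries the ceiling unit, its factor-0 b-leg and the
unit law's server, then the server's N-copy is PRESENT (unit law, contrapositive) — and that N-cell is the mixed head's b-leg; if moreover the
mixed head and ITS server are present, the mixed server's N-copy is present too. (Pure logic on §3 and §8; recorded for the ladder's cascade
bookkeeping, census-neutral.) -/
theorem cascade_seam (h : ℤ) (S : MConfig) (hD : S.InDiamond h) (hcl : A2IMinusClosed (S.dual h))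
    (hP0 : unit h ∈ S.upper) (hN0 : bLeg h ∈ S.lower) (hP1 : server h ∈ S.upper)
    (hPM : headM h ∈ S.upper) (hP1M : serverM h ∈ S.upper) : server h ∈ S.lower ∧ serverM h ∈ S.lower := by
  have h1 : server h ∈ S.lower := by
    by_contra hX
    exact unit_law h S hD hP0 hN0 hP1 hX hcl
  refine ⟨h1, ?_⟩
  by_contra hXM
  exact mixed_law h S hD hPM (bLegM_eq_server h ▸ h1) hP1M hXM hcl


/-! ## §9 THE CHARGE-LIFT LAW — uniform in the height AND in the charge (the cascade behind §3 and §8) -/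

/-- `ι_h((h−2c)I+cℓ₁) = (c,−c,0)`. -/
def cS (c : ℤ) : BPoint := (c, -c, 0)

/-- the lifted head `[((h−2)I+ℓ₁)³ ∣ (h−2c)I+cℓ₁]` in dual coordinates (c = 1: the unit `Zd`; c = 2: the mixed cell `ZdM`). -/
def ZdL (c : ℤ) : MCell := mcellOf xS xS xS (cS c)

/-- its partner: the dual of the b-leg `[hI ∣ ((h−2)I+ℓ₁)² ∣ (h−2c)I+cℓ₁]`. -/
def qdL (c : ℤ) : MCell := mcellOf oS xS xS (cS c)

/-- its server in dual coordinates: factor 3 lifted by one more charge. -/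
def NdL (c : ℤ) : MCell := mcellOf oS xS xS (cS (c + 1))

/-- the lifted head `[((h−2)I+ℓ₁)³ ∣ (h−2c)I+cℓ₁]` at height `h` (`headL h 1 = unit h`, `headL h 2 = headM h`). -/
def headL (h c : ℤ) : MCell := mcellOf (h - 1, 1, 0) (h - 1, 1, 0) (h - 1, 1, 0) (h - c, c, 0)

/-- its factor-0 b-leg `[hI ∣ ((h−2)I+ℓ₁)² ∣ (h−2c)I+cℓ₁]`. -/
def bLegL (h c : ℤ) : MCell := mcellOf (h, 0, 0) (h - 1, 1, 0) (h - 1, 1, 0) (h - c, c, 0)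

/-- its server `[hI ∣ ((h−2)I+ℓ₁)² ∣ (h−2c−2)I+(c+1)ℓ₁]` — whose letters, as an N-cell, are the NEXT b-leg `bLegL h (c+1)`. -/
def serverL (h c : ℤ) : MCell := mcellOf (h, 0, 0) (h - 1, 1, 0) (h - 1, 1, 0) (h - (c + 1), c + 1, 0)

/-- THE CASCADE SEAM, by `rfl`: the server of step `c` is the b-leg of step `c + 1`. -/
theorem bLegL_succ (h c : ℤ) : bLegL h (c + 1) = serverL h c := rfl

theorem headL_one (h : ℤ) : headL h 1 = unit h := rfl

theorem bLegL_one (h : ℤ) : bLegL h 1 = bLeg h := rfl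

theorem headL_two (h : ℤ) : headL h 2 = headM h := rfl

theorem serverL_one (h : ℤ) : serverL h 1 = server h := by
  funext f
  fin_cases f <;> simp [serverL, server, mcellOf]

theorem serverL_two (h : ℤ) : serverL h 2 = serverM h := by
  funext f
  fin_cases f <;> simp [serverL, serverM, mcellOf]

theorem ZdL_zero (c : ℤ) : ZdL c 0 = xS := rfl

theorem qdL_zero (c : ℤ) : qdL c 0 = oS := rfl

theorem dual_headL (h c : ℤ) : dualCell h (headL h c) = ZdL c := by
  funext f
  fin_cases f <;> simp [headL, ZdL, mcellOf, xS, cS, dualCell, dualPt]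

theorem dual_bLegL (h c : ℤ) : dualCell h (bLegL h c) = qdL c := by
  funext f
  fin_cases f <;> simp [bLegL, qdL, mcellOf, xS, cS, oS, dualCell, dualPt]

theorem dual_serverL (h c : ℤ) : dualCell h (serverL h c) = NdL c := by
  funext f
  fin_cases f <;> simp [serverL, NdL, mcellOf, xS, cS, oS, dualCell, dualPt]

theorem dual_NdL (h c : ℤ) : dualCell h (NdL c) = serverL h c := by
  rw [← dual_serverL h c, dualCell_dualCell]

theorem even_of_headL {h c : ℤ} {S : MConfig} (hD : S.InDiamond h) (hP0 : headL h c ∈ S.upper) : h % 2 = 0 := by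
  have hx := hD.2 _ hP0 0
  norm_num [headL, mcellOf, InDiamond, AxisPt, absCharge, chargeOf] at hx
  omega

set_option maxHeartbeats 8000000 in
/-- **THE CHARGE-LIFT LAW (all heights h, all charges c — no lower bound on `c` is needed; c ≤ 0 is vacuous or degenerate inside ◇_h).** On the ι_h-dual of any ◇_h-supported configuration containing the lifted
head `[((h−2)I+ℓ₁)³ ∣ (h−2c)I+cℓ₁]`, its factor-0 b-leg `[hI ∣ ((h−2)I+ℓ₁)² ∣ (h−2c)I+cℓ₁]` and the server
`[hI ∣ ((h−2)I+ℓ₁)² ∣ (h−2c−2)I+(c+1)ℓ₁]`, and NOT containing the N-cell with the server's letters, the A2I clause of record fires at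
`(ZdL c; σ = 0, u = 2; qdL c; f′ = 3, v = 2; NdL c)`. c = 1 is `unit_law` (§3), c = 2 is `mixed_law` (§8). The escapes on factor 3 are settled
for symbolic `c` by the two polynomial identities `(c+b₁)² − (c−a)² = (b₁+a)(b₁−a+2c)` (A1W: a strictly-null-below ◇-letter of `(c,−c,0)` lies on
its v-ray) and «effective-below-`(c+1,−c−1,0)` + spacelike-to-`(c,−c,0)` is linearly infeasible against causality» (species (3d)). -/
theorem lift_law (h c : ℤ) (S : MConfig) (hD : S.InDiamond h) (hP0 : headL h c ∈ S.upper)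
    (hN0 : bLegL h c ∈ S.lower) (hP1 : serverL h c ∈ S.upper) (hX : serverL h c ∉ S.lower) : ¬ A2IMinusClosed (S.dual h) := by
  have hev : h % 2 = 0 := even_of_headL hD hP0
  have hdia : ∀ P ∈ (S.dual h).upper, ∀ f, InDiamond h (dualPt h (P f)) := fun P hP f =>
    hD.1 _ (mem_dual_upper.mp hP) f
  have fires : XresA2IFires (S.dual h) (ZdL c) (qdL c) (NdL c) 0 2 3 2 := by
    refine ⟨?_, ?_, ?_, ?_, by decide, ?_, ?_, ?_, ?_, ?_, ?_⟩
    · rw [ZdL_zero]; decide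
    · rw [ZdL_zero]; decide
    · -- the partner: agreement off factor 0, depth 1 on the u-line of `(1,−1,0)`
      refine ⟨?_, ?_, ?_⟩
      · intro g hg
        fin_cases g <;> simp_all [ZdL, qdL, mcellOf]
      · rw [ZdL_zero, qdL_zero]; decide
      · rw [ZdL_zero, qdL_zero]; decide
    · rw [ZdL_zero, qdL_zero]; decide
    · -- the server is the v-partner of the partner on factor 3, one charge up
      refine ⟨?_, ?_, ?_⟩
      · intro g hg
        fin_cases g <;> simp_all [NdL, qdL, mcellOf]
      · simp [NdL, qdL, cS, mcellOf]
      · (simp [NdL, qdL, cS, mcellOf, ray, Prod.ext_iff]; omega)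
    · -- (7) no partner of the head on factor 0 in another direction
      intro P hP w hw hU
      obtain ⟨d1, d2, d3, -⟩ := dia_dual (hdia P hP 0)
      obtain ⟨-, hlt, heq⟩ := hU
      fin_cases w <;> simp [ZdL, xS, mcellOf, ray, Prod.ext_iff] at hlt heq hw <;> omega
    · -- (8) no shallower u-partner (the partner is at depth 1)
      intro P hP hU
      obtain ⟨-, hlt, -⟩ := hU
      simp [ZdL, qdL, xS, oS, mcellOf] at hlt ⊢
      omega
    · -- (9) nothing below the partner on the u-line
      intro P hP hU
      obtain ⟨d1, d2, d3, -⟩ := dia_dual (hdia P hP 0)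
      obtain ⟨-, hlt, -⟩ := hU
      simp [qdL, oS, mcellOf] at hlt
      omega
    · -- (10) A1W on factor 3: a strictly-null-below ◇-letter `(a,b₁,b₂)` of `(c,−c,0)` has `b₁ = −a`, `b₂ = 0` (on the v-ray)
      intro P hP hnb _
      obtain ⟨d1, d2, d3, -⟩ := dia_dual (hdia P hP 3)
      obtain ⟨hlt, hnull⟩ := hnb
      simp [ZdL, cS, mcellOf, ray, Prod.ext_iff] at hlt hnull ⊢
      generalize hp : P 3 = p at hlt hnull d1 d2 d3 ⊢
      obtain ⟨a, b1, b2⟩ := p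
      simp only at hlt hnull d1 d2 d3 ⊢
      have ha : 0 ≤ a := by omega
      have key : b1 = -a ∧ b2 = 0 := by
        rcases d1 with hb | hb
        · subst hb
          have h2 : 0 ≤ a * (2 * c - a) := mul_nonneg ha (by omega)
          have hb2 : b2 ^ 2 = 0 := by nlinarith [sq_nonneg b2]
          have hb2' : b2 = 0 := pow_eq_zero_iff (two_ne_zero) |>.mp hb2
          subst hb2'
          have h3 : a * (2 * c - a) = 0 := by nlinarith
          rcases mul_eq_zero.mp h3 with h0 | h0 <;> omega
        · subst hb
          refine ⟨?_, rfl⟩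
          have h1 : (b1 + a) * (b1 - a + 2 * c) = 0 := by nlinarith
          rcases mul_eq_zero.mp h1 with h0 | h0 <;> omega
      obtain ⟨hk1, hk2⟩ := key
      subst hk1 hk2
      omega
    · -- (11) polluters of the server row: species (3b) forces `P = NdL c` (absent by `hX`), species (3d) is infeasible
      intro P hP hag hul
      obtain ⟨d1, d2, d3, -⟩ := dia_dual (hdia P hP 0)
      obtain ⟨e1, e2, e3, e4⟩ := dia_dual (hdia P hP 3)
      obtain ⟨hle, heq⟩ := hul
      simp [qdL, oS, mcellOf, ray, Prod.ext_iff] at hle heq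
      have ha0 : (P 0).1 = 0 := by omega
      have hb0 : (P 0).2.1 = 0 := by omega
      have hc0 : (P 0).2.2 = 0 := by omega
      constructor
      · rintro ⟨h1, h2, h3⟩
        simp [ZdL, NdL, cS, mcellOf] at h1 h2
        have ha3 : (P 3).1 = c + 1 := by omega
        have hP3 : P 3 = cS (c + 1) := by
          rw [h3]
          (simp [ZdL, cS, mcellOf, ray, ha3, Prod.ext_iff]; omega)
        have hPN : P = NdL c := by
          funext f
          fin_cases f
          · exact Prod.ext ha0 (Prod.ext hb0 hc0)
          · simpa [ZdL, NdL, mcellOf] using hag 1 (by decide) (by decide)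
          · simpa [ZdL, NdL, mcellOf] using hag 2 (by decide) (by decide)
          · simpa [NdL, mcellOf] using hP3
        apply hX
        rw [← dual_NdL h c, ← hPN]
        exact mem_dual_upper.mp hP
      · rintro ⟨⟨hE1, hE2⟩, hSp⟩
        simp [ZdL, NdL, cS, mcellOf] at hE1 hE2 hSp
        generalize hp : P 3 = p at hE1 hE2 hSp e1 e2 e3 e4
        obtain ⟨a, b1, b2⟩ := p
        simp only at hE1 hE2 hSp e1 e2 e3 e4
        have ha : 0 ≤ a := by omega
        rcases e1 with hb | hb <;> subst hb <;> nlinarith [hE2, hSp, e2, e3, ha]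
  intro hcl
  refine hcl (ZdL c) ?_ (qdL c) ?_ (NdL c) ?_ 0 2 3 2 fires
  · rw [← dual_headL h c]; exact dualCell_mem_dual_lower hP0
  · rw [← dual_bLegL h c]; exact dualCell_mem_dual_upper hN0
  · rw [← dual_serverL h c]; exact dualCell_mem_dual_lower hP1

/-- **THE A♭ CASCADE (all heights; kernel).** Let `S` be ◇_h-supported with A♭_h-STATIC dual, containing the ceiling unit's factor-0 b-leg
`[hI ∣ ((h−2)I+ℓ₁)³]`. If for every charge `c = 1, …, n+1` the lifted head `[((h−2)I+ℓ₁)³ ∣ (h−2c)I+cℓ₁]` (c = 1: the unit itself) and the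
server `[hI ∣ ((h−2)I+ℓ₁)² ∣ (h−2c−2)I+(c+1)ℓ₁]` are present as P-cells, then EVERY server is also present as an N-cell: the unit law forces
the first, and each forced N-cell is the b-leg through which the next lifted head fires (`bLegL_succ`). Pure induction on `lift_law`. -/
theorem cascade (h : ℤ) (S : MConfig) (hD : S.InDiamond h) (hcl : A2IMinusClosed (S.dual h)) (hN0 : bLeg h ∈ S.lower) :
    ∀ n : ℕ, (∀ k : ℕ, k ≤ n → headL h (k + 1) ∈ S.upper ∧ serverL h (k + 1) ∈ S.upper) →
      ∀ k : ℕ, k ≤ n → serverL h (k + 1) ∈ S.lower := by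
  intro n
  induction n with
  | zero =>
    intro hp k hk
    obtain rfl : k = 0 := Nat.le_zero.mp hk
    obtain ⟨hP0, hP1⟩ := hp 0 le_rfl
    by_contra hX
    simp only [Nat.cast_zero, zero_add] at hP0 hP1 hX
    exact lift_law h 1 S hD hP0 (by rw [bLegL_one]; exact hN0) hP1 hX hcl
  | succ n ih =>
    intro hp k hk
    rcases Nat.lt_or_ge k (n + 1) with hlt | hge
    · exact ih (fun k hk => hp k (by omega)) k (by omega)
    · obtain rfl : k = n + 1 := le_antisymm hk hge
      obtain ⟨hP0, hP1⟩ := hp (n + 1) le_rfl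
      have hprev : serverL h ((n : ℤ) + 1) ∈ S.lower := ih (fun k hk => hp k (by omega)) n le_rfl
      by_contra hX
      simp only [Nat.cast_succ] at hP0 hP1 hX
      exact lift_law h ((n : ℤ) + 1 + 1) S hD hP0 (by rw [bLegL_succ]; exact hprev) hP1 hX hcl


/-! ## §10 `G₁`-covariant forms of the charge-lift law (every factor pair, every phase; §5's transport verbatim) -/

/-- **the charge-lift law for every factor pair**: head, b-leg and server re-indexed by any `τ ∈ S₄`, same conclusion.
[`lift_law` on `S.permImage τ⁻¹`, transported by `dual_permImage` + `a2iMinusClosed_permImage`.] -/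
theorem lift_law_perm (h c : ℤ) (τ : Equiv.Perm (Fin 4)) (S : MConfig) (hD : S.InDiamond h) (hP0 : (headL h c).perm τ ∈ S.upper)
    (hN0 : (bLegL h c).perm τ ∈ S.lower) (hP1 : (serverL h c).perm τ ∈ S.upper) (hX : (serverL h c).perm τ ∉ S.lower) :
    ¬ A2IMinusClosed (S.dual h) := by
  have key := lift_law h c (S.permImage τ⁻¹) ((inDiamond_permImage_iff τ⁻¹ S h).mpr hD)
    ((mem_permImage_upper _ _).mpr ⟨_, hP0, MCell.perm_perm_inv τ _⟩)
    ((mem_permImage_lower _ _).mpr ⟨_, hN0, MCell.perm_perm_inv τ _⟩)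
    ((mem_permImage_upper _ _).mpr ⟨_, hP1, MCell.perm_perm_inv τ _⟩)
    (by
      intro hmem
      obtain ⟨Z, hZ, hZe⟩ := (mem_permImage_lower _ _).mp hmem
      apply hX
      have hZ' : Z = (serverL h c).perm τ := by
        rw [← hZe, MCell.perm_inv_perm]
      rw [← hZ']
      exact hZ)
  rwa [dual_permImage, a2iMinusClosed_permImage] at key

/-- **the charge-lift law for every phase and every factor pair** (`G₁ = ⟨Δ⟩ × S₄`-covariant form): everything rotated by the global phase
`Δ^k` on top of the re-indexing. [`lift_law_perm` on `S.phaseImage (cvec (−k))`, transported by `dual_phaseImage_height` + LEMMA T.] -/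
theorem lift_law_G1 (h c : ℤ) (k : Fin 4) (τ : Equiv.Perm (Fin 4)) (S : MConfig) (hD : S.InDiamond h)
    (hP0 : ((headL h c).perm τ).phase (cvec k) ∈ S.upper) (hN0 : ((bLegL h c).perm τ).phase (cvec k) ∈ S.lower)
    (hP1 : ((serverL h c).perm τ).phase (cvec k) ∈ S.upper) (hX : ((serverL h c).perm τ).phase (cvec k) ∉ S.lower) :
    ¬ A2IMinusClosed (S.dual h) := by
  have key := lift_law_perm h c τ (S.phaseImage (cvec (-k))) ((inDiamond_phaseImage (cvec (-k)) S h).mpr hD)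
    (mem_phaseImage_upper.mpr ⟨_, hP0, phase_cvec_neg_cvec k _⟩)
    (mem_phaseImage_lower.mpr ⟨_, hN0, phase_cvec_neg_cvec k _⟩)
    (mem_phaseImage_upper.mpr ⟨_, hP1, phase_cvec_neg_cvec k _⟩)
    (by
      intro hmem
      obtain ⟨Z, hZ, hZe⟩ := mem_phaseImage_lower.mp hmem
      apply hX
      have hZ' : Z = ((serverL h c).perm τ).phase (cvec k) := by
        rw [← hZe, phase_neg_cvec_cvec]
      rw [← hZ']
      exact hZ)
  rwa [dual_phaseImage_height, a2iMinusClosed_phaseImage] at key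


/-! ## §11 THE TWO-FACTOR LAW — the other two letters are ARBITRARY (final h-, c- and letter-uniform form of §3 ∕ §8 ∕ §9) -/

/-- the two-factor head `[(h−2)I+ℓ₁ ∣ p₁ ∣ p₂ ∣ (h−2c)I+cℓ₁]` — factor 0 the unit letter, factor 3 the charge-c letter, factors 1, 2 ANY points. -/
def headT (h c : ℤ) (p₁ p₂ : BPoint) : MCell := mcellOf (h - 1, 1, 0) p₁ p₂ (h - c, c, 0)

/-- its factor-0 b-leg `[hI ∣ p₁ ∣ p₂ ∣ (h−2c)I+cℓ₁]`. -/
def bLegT (h c : ℤ) (p₁ p₂ : BPoint) : MCell := mcellOf (h, 0, 0) p₁ p₂ (h - c, c, 0)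

/-- its server `[hI ∣ p₁ ∣ p₂ ∣ (h−2c−2)I+(c+1)ℓ₁]`. -/
def serverT (h c : ℤ) (p₁ p₂ : BPoint) : MCell := mcellOf (h, 0, 0) p₁ p₂ (h - (c + 1), c + 1, 0)

/-- the instance in dual coordinates. -/
def ZdT (h c : ℤ) (p₁ p₂ : BPoint) : MCell := mcellOf xS (dualPt h p₁) (dualPt h p₂) (cS c)

def qdT (h c : ℤ) (p₁ p₂ : BPoint) : MCell := mcellOf oS (dualPt h p₁) (dualPt h p₂) (cS c)

def NdT (h c : ℤ) (p₁ p₂ : BPoint) : MCell := mcellOf oS (dualPt h p₁) (dualPt h p₂) (cS (c + 1))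

theorem headT_diag (h c : ℤ) : headT h c (h - 1, 1, 0) (h - 1, 1, 0) = headL h c := rfl

theorem bLegT_diag (h c : ℤ) : bLegT h c (h - 1, 1, 0) (h - 1, 1, 0) = bLegL h c := rfl

theorem serverT_diag (h c : ℤ) : serverT h c (h - 1, 1, 0) (h - 1, 1, 0) = serverL h c := rfl

/-- the cascade seam in the two-factor form, by `rfl`. -/
theorem bLegT_succ (h c : ℤ) (p₁ p₂ : BPoint) : bLegT h (c + 1) p₁ p₂ = serverT h c p₁ p₂ := rfl

theorem ZdT_zero (h c : ℤ) (p₁ p₂ : BPoint) : ZdT h c p₁ p₂ 0 = xS := rfl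

theorem qdT_zero (h c : ℤ) (p₁ p₂ : BPoint) : qdT h c p₁ p₂ 0 = oS := rfl

theorem dual_headT (h c : ℤ) (p₁ p₂ : BPoint) : dualCell h (headT h c p₁ p₂) = ZdT h c p₁ p₂ := by
  funext f
  fin_cases f <;> simp [headT, ZdT, mcellOf, xS, cS, dualCell, dualPt]

theorem dual_bLegT (h c : ℤ) (p₁ p₂ : BPoint) : dualCell h (bLegT h c p₁ p₂) = qdT h c p₁ p₂ := by
  funext f
  fin_cases f <;> simp [bLegT, qdT, mcellOf, cS, oS, dualCell, dualPt]

theorem dual_serverT (h c : ℤ) (p₁ p₂ : BPoint) : dualCell h (serverT h c p₁ p₂) = NdT h c p₁ p₂ := by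
  funext f
  fin_cases f <;> simp [serverT, NdT, mcellOf, cS, oS, dualCell, dualPt]

theorem dual_NdT (h c : ℤ) (p₁ p₂ : BPoint) : dualCell h (NdT h c p₁ p₂) = serverT h c p₁ p₂ := by
  rw [← dual_serverT h c p₁ p₂, dualCell_dualCell]

theorem even_of_headT {h c : ℤ} {p₁ p₂ : BPoint} {S : MConfig} (hD : S.InDiamond h) (hP0 : headT h c p₁ p₂ ∈ S.upper) :
    h % 2 = 0 := by
  have hx := hD.2 _ hP0 0
  norm_num [headT, mcellOf, InDiamond, AxisPt, absCharge, chargeOf] at hx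
  omega

set_option maxHeartbeats 8000000 in
/-- **THE TWO-FACTOR LAW (all heights, all charges, factors 1 and 2 arbitrary).** On the ι_h-dual of any ◇_h-supported configuration
containing a P-cell `[(h−2)I+ℓ₁ ∣ p₁ ∣ p₂ ∣ (h−2c)I+cℓ₁]`, its factor-0 b-leg `[hI ∣ p₁ ∣ p₂ ∣ (h−2c)I+cℓ₁]` (N-cell) and the server
`[hI ∣ p₁ ∣ p₂ ∣ (h−2c−2)I+(c+1)ℓ₁]` (P-cell), and NOT containing the N-cell with the server's letters, the A2I clause of record fires at
`(ZdT; σ = 0, u = 2; qdT; f′ = 3, v = 2; NdT)`. The five escapes only ever inspect the letters on factors σ and f′ (and agreement elsewhere),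
so `p₁, p₂` are free; `p₁ = p₂ = (h−2)I+ℓ₁` is `lift_law` (§9), hence `unit_law` (c = 1) and `mixed_law` (c = 2). With §10's transport this is
the law for every factor pair and every phase. -/
theorem twoFactor_law (h c : ℤ) (p₁ p₂ : BPoint) (S : MConfig) (hD : S.InDiamond h) (hP0 : headT h c p₁ p₂ ∈ S.upper)
    (hN0 : bLegT h c p₁ p₂ ∈ S.lower) (hP1 : serverT h c p₁ p₂ ∈ S.upper) (hX : serverT h c p₁ p₂ ∉ S.lower) :
    ¬ A2IMinusClosed (S.dual h) := by
  have hev : h % 2 = 0 := even_of_headT hD hP0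
  have hdia : ∀ P ∈ (S.dual h).upper, ∀ f, InDiamond h (dualPt h (P f)) := fun P hP f =>
    hD.1 _ (mem_dual_upper.mp hP) f
  have fires : XresA2IFires (S.dual h) (ZdT h c p₁ p₂) (qdT h c p₁ p₂) (NdT h c p₁ p₂) 0 2 3 2 := by
    refine ⟨?_, ?_, ?_, ?_, by decide, ?_, ?_, ?_, ?_, ?_, ?_⟩
    · rw [ZdT_zero]; decide
    · rw [ZdT_zero]; decide
    · refine ⟨?_, ?_, ?_⟩
      · intro g hg
        fin_cases g <;> simp_all [ZdT, qdT, mcellOf]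
      · rw [ZdT_zero, qdT_zero]; decide
      · rw [ZdT_zero, qdT_zero]; decide
    · rw [ZdT_zero, qdT_zero]; decide
    · refine ⟨?_, ?_, ?_⟩
      · intro g hg
        fin_cases g <;> simp_all [NdT, qdT, mcellOf]
      · simp [NdT, qdT, cS, mcellOf]
      · (simp [NdT, qdT, cS, mcellOf, ray, Prod.ext_iff]; omega)
    · -- (7)
      intro P hP w hw hU
      obtain ⟨d1, d2, d3, -⟩ := dia_dual (hdia P hP 0)
      obtain ⟨-, hlt, heq⟩ := hU
      fin_cases w <;> simp [ZdT, xS, mcellOf, ray, Prod.ext_iff] at hlt heq hw <;> omega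
    · -- (8)
      intro P hP hU
      obtain ⟨-, hlt, -⟩ := hU
      simp [ZdT, qdT, xS, oS, mcellOf] at hlt ⊢
      omega
    · -- (9)
      intro P hP hU
      obtain ⟨d1, d2, d3, -⟩ := dia_dual (hdia P hP 0)
      obtain ⟨-, hlt, -⟩ := hU
      simp [qdT, oS, mcellOf] at hlt
      omega
    · -- (10)
      intro P hP hnb _
      obtain ⟨d1, d2, d3, -⟩ := dia_dual (hdia P hP 3)
      obtain ⟨hlt, hnull⟩ := hnb
      simp [ZdT, cS, mcellOf, ray, Prod.ext_iff] at hlt hnull ⊢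
      generalize hp : P 3 = p at hlt hnull d1 d2 d3 ⊢
      obtain ⟨a, b1, b2⟩ := p
      simp only at hlt hnull d1 d2 d3 ⊢
      have ha : 0 ≤ a := by omega
      have key : b1 = -a ∧ b2 = 0 := by
        rcases d1 with hb | hb
        · subst hb
          have h2 : 0 ≤ a * (2 * c - a) := mul_nonneg ha (by omega)
          have hb2 : b2 ^ 2 = 0 := by nlinarith [sq_nonneg b2]
          have hb2' : b2 = 0 := pow_eq_zero_iff (two_ne_zero) |>.mp hb2
          subst hb2'
          have h3 : a * (2 * c - a) = 0 := by nlinarith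
          rcases mul_eq_zero.mp h3 with h0 | h0 <;> omega
        · subst hb
          refine ⟨?_, rfl⟩
          have h1 : (b1 + a) * (b1 - a + 2 * c) = 0 := by nlinarith
          rcases mul_eq_zero.mp h1 with h0 | h0 <;> omega
      obtain ⟨hk1, hk2⟩ := key
      subst hk1 hk2
      omega
    · -- (11)
      intro P hP hag hul
      obtain ⟨d1, d2, d3, -⟩ := dia_dual (hdia P hP 0)
      obtain ⟨e1, e2, e3, e4⟩ := dia_dual (hdia P hP 3)
      obtain ⟨hle, heq⟩ := hul
      simp [qdT, oS, mcellOf, ray, Prod.ext_iff] at hle heq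
      have ha0 : (P 0).1 = 0 := by omega
      have hb0 : (P 0).2.1 = 0 := by omega
      have hc0 : (P 0).2.2 = 0 := by omega
      constructor
      · rintro ⟨h1, h2, h3⟩
        simp [ZdT, NdT, cS, mcellOf] at h1 h2
        have ha3 : (P 3).1 = c + 1 := by omega
        have hP3 : P 3 = cS (c + 1) := by
          rw [h3]
          (simp [ZdT, cS, mcellOf, ray, ha3, Prod.ext_iff]; omega)
        have hPN : P = NdT h c p₁ p₂ := by
          funext f
          fin_cases f
          · exact Prod.ext ha0 (Prod.ext hb0 hc0)
          · simpa [ZdT, NdT, mcellOf] using hag 1 (by decide) (by decide)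
          · simpa [ZdT, NdT, mcellOf] using hag 2 (by decide) (by decide)
          · simpa [NdT, mcellOf] using hP3
        apply hX
        rw [← dual_NdT h c p₁ p₂, ← hPN]
        exact mem_dual_upper.mp hP
      · rintro ⟨⟨hE1, hE2⟩, hSp⟩
        simp [ZdT, NdT, cS, mcellOf] at hE1 hE2 hSp
        generalize hp : P 3 = p at hE1 hE2 hSp e1 e2 e3 e4
        obtain ⟨a, b1, b2⟩ := p
        simp only at hE1 hE2 hSp e1 e2 e3 e4
        have ha : 0 ≤ a := by omega
        rcases e1 with hb | hb <;> subst hb <;> nlinarith [hE2, hSp, e2, e3, ha]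
  intro hcl
  refine hcl (ZdT h c p₁ p₂) ?_ (qdT h c p₁ p₂) ?_ (NdT h c p₁ p₂) ?_ 0 2 3 2 fires
  · rw [← dual_headT h c p₁ p₂]; exact dualCell_mem_dual_lower hP0
  · rw [← dual_bLegT h c p₁ p₂]; exact dualCell_mem_dual_upper hN0
  · rw [← dual_serverT h c p₁ p₂]; exact dualCell_mem_dual_lower hP1

/-- `lift_law` (§9) is the diagonal case `p₁ = p₂ = (h−2)I+ℓ₁` of the two-factor law (a second proof, by specialisation). -/
theorem lift_law' (h c : ℤ) (S : MConfig) (hD : S.InDiamond h) (hP0 : headL h c ∈ S.upper)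
    (hN0 : bLegL h c ∈ S.lower) (hP1 : serverL h c ∈ S.upper) (hX : serverL h c ∉ S.lower) : ¬ A2IMinusClosed (S.dual h) :=
  twoFactor_law h c (h - 1, 1, 0) (h - 1, 1, 0) S hD hP0 hN0 hP1 hX

/-- **the two-factor law for every factor pair and every phase** (`S₄ × ⟨Δ⟩` transport of §10 applied to §11). -/
theorem twoFactor_law_G1 (h c : ℤ) (p₁ p₂ : BPoint) (k : Fin 4) (τ : Equiv.Perm (Fin 4)) (S : MConfig) (hD : S.InDiamond h)
    (hP0 : ((headT h c p₁ p₂).perm τ).phase (cvec k) ∈ S.upper) (hN0 : ((bLegT h c p₁ p₂).perm τ).phase (cvec k) ∈ S.lower)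
    (hP1 : ((serverT h c p₁ p₂).perm τ).phase (cvec k) ∈ S.upper) (hX : ((serverT h c p₁ p₂).perm τ).phase (cvec k) ∉ S.lower) :
    ¬ A2IMinusClosed (S.dual h) := by
  -- permutation step
  have perm_step : ∀ (T : MConfig), T.InDiamond h → (headT h c p₁ p₂).perm τ ∈ T.upper → (bLegT h c p₁ p₂).perm τ ∈ T.lower →
      (serverT h c p₁ p₂).perm τ ∈ T.upper → (serverT h c p₁ p₂).perm τ ∉ T.lower → ¬ A2IMinusClosed (T.dual h) := by
    intro T hT h0 h1 h2 h3
    have key := twoFactor_law h c p₁ p₂ (T.permImage τ⁻¹) ((inDiamond_permImage_iff τ⁻¹ T h).mpr hT)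
      ((mem_permImage_upper _ _).mpr ⟨_, h0, MCell.perm_perm_inv τ _⟩)
      ((mem_permImage_lower _ _).mpr ⟨_, h1, MCell.perm_perm_inv τ _⟩)
      ((mem_permImage_upper _ _).mpr ⟨_, h2, MCell.perm_perm_inv τ _⟩)
      (by
        intro hmem
        obtain ⟨Z, hZ, hZe⟩ := (mem_permImage_lower _ _).mp hmem
        apply h3
        have hZ' : Z = (serverT h c p₁ p₂).perm τ := by
          rw [← hZe, MCell.perm_inv_perm]
        rw [← hZ']
        exact hZ)
    rwa [dual_permImage, a2iMinusClosed_permImage] at key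
  -- phase step
  have key := perm_step (S.phaseImage (cvec (-k))) ((inDiamond_phaseImage (cvec (-k)) S h).mpr hD)
    (mem_phaseImage_upper.mpr ⟨_, hP0, phase_cvec_neg_cvec k _⟩)
    (mem_phaseImage_lower.mpr ⟨_, hN0, phase_cvec_neg_cvec k _⟩)
    (mem_phaseImage_upper.mpr ⟨_, hP1, phase_cvec_neg_cvec k _⟩)
    (by
      intro hmem
      obtain ⟨Z, hZ, hZe⟩ := mem_phaseImage_lower.mp hmem
      apply hX
      have hZ' : Z = ((serverT h c p₁ p₂).perm τ).phase (cvec k) := by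
        rw [← hZe, phase_neg_cvec_cvec]
      rw [← hZ']
      exact hZ)
  rwa [dual_phaseImage_height, a2iMinusClosed_phaseImage] at key


/-! ## §12 (v1.7, g6 — A12) THE FOUR MIXED CEILING-UNIT ORBITS and THE EXCLUSION SCHEMA (append-only; one-line specialisations of §11)
The H₁^{G₁} peel at ◇₁₀ (kit j318002, table 74004db439790926) leaves exactly four MIXED-phase ceiling-unit `P`-orbits alive besides the uniform
unit: the two ODD ones `P[((h−2)I+ℓ₋₁)³ ∣ (h−2)I+ℓ_{±i}]` (solver-dead, propagation-alive) and the two ANTIPODAL ones `P[((h−2)I+ℓ₋₁)³ ∣ (h−2)I+ℓ₁]`,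
`P[((h−2)I+ℓ₋₁)² ∣ ((h−2)I+ℓ₁)²]` (solver-open; kit j322459 STAGE C∕B). Each is, up to `G₁ = S₄ × ⟨Δ⟩`, a two-factor head `headT h 1 (h−1,1,0) p₂`
(resp. `headT h 1 p p`) of §11, so `twoFactor_law` is its A♭_h law BY NAME; `head_excluded_of_chain` packages the law as an EXCLUSION of the head
from every A♭_h-static ◇_h-support in which (i) the head forces its b-leg (RULE D at the head: the typed DP menu is the single b-leg —
third code gs2∕g54∕kit8, and control's kernel `antipodalServer_of_ceiling_letter`, B1OddTowerLaws §16), (ii) the b-leg forces the server (at ◇₁₀,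
for the two ODD orbits: the typed DN menu of `N[10I ∣ (8I+ℓ₋₁)² ∣ 8I+ℓ_{±i}]` at the pair `(g,j,k,k′) = (0,1,2,0)` has 79 cells of which 78 are
peel-REFUTED and the sole survivor is the server `P[10I ∣ 8I+ℓ₋₁ ∣ 8I+ℓ_{±i} ∣ 6I+2ℓ₋₁]` — instrument ×1, HOME `a9/g6-menu-D8-D10.txt`), and (iii) the
server's N-copy is absent (peel-refuted at ◇₁₀: round 24 `P:DP` for the odd and the 3+1 antipodal orbit, round 25 `B:DN` for the 2+2 one).
(i)–(iii) are DISPLAYED HYPOTHESES here (census facts, not kernel facts); the kernel content is §11. Phases: `ℓ₁ ↔ β = (1,0)`, `ℓ₋₁ ↔ (−1,0)`,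
third-code `ℓ_i ↔ (0,−1)`, `ℓ₋ᵢ ↔ (0,1)`; the census names are the `Δ²`-images of the cells below. NOTHING HERE SAYS HC ∕ HC_CM ∕ HC_AV ∕ H2 HOLDS. -/

/-- **EXCLUSION SCHEMA.** If `S^{ι_h}` is `A2I⁻`-closed (S is A♭_h-static), the head forces its factor-0 b-leg, the b-leg forces the server, and
the server's N-copy is absent, then the two-factor head is ABSENT. (Pure logic on `twoFactor_law`; the three implications are the census side.) -/
theorem head_excluded_of_chain (h c : ℤ) (p₁ p₂ : BPoint) (S : MConfig) (hD : S.InDiamond h) (hcl : A2IMinusClosed (S.dual h))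
    (hDP : headT h c p₁ p₂ ∈ S.upper → bLegT h c p₁ p₂ ∈ S.lower) (hDN : bLegT h c p₁ p₂ ∈ S.lower → serverT h c p₁ p₂ ∈ S.upper)
    (hX : serverT h c p₁ p₂ ∉ S.lower) : headT h c p₁ p₂ ∉ S.upper :=
  fun hP0 => twoFactor_law h c p₁ p₂ S hD hP0 (hDP hP0) (hDN (hDP hP0)) hX hcl

/-- the `G₁`-covariant exclusion schema (every factor pair, every phase). -/
theorem head_excluded_of_chain_G1 (h c : ℤ) (p₁ p₂ : BPoint) (k : Fin 4) (τ : Equiv.Perm (Fin 4)) (S : MConfig) (hD : S.InDiamond h)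
    (hcl : A2IMinusClosed (S.dual h))
    (hDP : ((headT h c p₁ p₂).perm τ).phase (cvec k) ∈ S.upper → ((bLegT h c p₁ p₂).perm τ).phase (cvec k) ∈ S.lower)
    (hDN : ((bLegT h c p₁ p₂).perm τ).phase (cvec k) ∈ S.lower → ((serverT h c p₁ p₂).perm τ).phase (cvec k) ∈ S.upper)
    (hX : ((serverT h c p₁ p₂).perm τ).phase (cvec k) ∉ S.lower) : ((headT h c p₁ p₂).perm τ).phase (cvec k) ∉ S.upper :=
  fun hP0 => twoFactor_law_G1 h c p₁ p₂ k τ S hD hP0 (hDP hP0) (hDN (hDP hP0)) hX hcl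

/-- ODD ceiling-unit orbit, chirality `+i` (kit tag `oddcu-plus-i`, census `P[((h−2)I+ℓ₋₁)³ ∣ (h−2)I+ℓ_i]`; here its `Δ²`-image
`[(h−2)I+ℓ₁ ∣ (h−2)I+ℓ₁ ∣ (h−2)I+ℓ₋ᵢ ∣ (h−2)I+ℓ₁]`): A♭_h fires given the factor-0 b-leg, the server `[hI ∣ (h−2)I+ℓ₁ ∣ (h−2)I+ℓ₋ᵢ ∣ (h−4)I+2ℓ₁]`
and the absence of the server's N-copy. -/
theorem oddPlusI_law (h : ℤ) (S : MConfig) (hD : S.InDiamond h) (hP0 : headT h 1 (h - 1, 1, 0) (h - 1, 0, 1) ∈ S.upper)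
    (hN0 : bLegT h 1 (h - 1, 1, 0) (h - 1, 0, 1) ∈ S.lower) (hP1 : serverT h 1 (h - 1, 1, 0) (h - 1, 0, 1) ∈ S.upper)
    (hX : serverT h 1 (h - 1, 1, 0) (h - 1, 0, 1) ∉ S.lower) : ¬ A2IMinusClosed (S.dual h) :=
  twoFactor_law h 1 (h - 1, 1, 0) (h - 1, 0, 1) S hD hP0 hN0 hP1 hX

/-- ODD ceiling-unit orbit, chirality `−i` (kit tag `oddcu-minus-i`, census `P[((h−2)I+ℓ₋₁)³ ∣ (h−2)I+ℓ₋ᵢ]`; `Δ²`-image with `(h−1,0,−1)`). -/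
theorem oddMinusI_law (h : ℤ) (S : MConfig) (hD : S.InDiamond h) (hP0 : headT h 1 (h - 1, 1, 0) (h - 1, 0, -1) ∈ S.upper)
    (hN0 : bLegT h 1 (h - 1, 1, 0) (h - 1, 0, -1) ∈ S.lower) (hP1 : serverT h 1 (h - 1, 1, 0) (h - 1, 0, -1) ∈ S.upper)
    (hX : serverT h 1 (h - 1, 1, 0) (h - 1, 0, -1) ∉ S.lower) : ¬ A2IMinusClosed (S.dual h) :=
  twoFactor_law h 1 (h - 1, 1, 0) (h - 1, 0, -1) S hD hP0 hN0 hP1 hX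

/-- ANTIPODAL 3+1 ceiling-unit orbit (kit tag `antimix31`, census `P[((h−2)I+ℓ₋₁)³ ∣ (h−2)I+ℓ₁]`; `Δ²`-image with `(h−1,−1,0)`). -/
theorem antimix31_law (h : ℤ) (S : MConfig) (hD : S.InDiamond h) (hP0 : headT h 1 (h - 1, 1, 0) (h - 1, -1, 0) ∈ S.upper)
    (hN0 : bLegT h 1 (h - 1, 1, 0) (h - 1, -1, 0) ∈ S.lower) (hP1 : serverT h 1 (h - 1, 1, 0) (h - 1, -1, 0) ∈ S.upper)
    (hX : serverT h 1 (h - 1, 1, 0) (h - 1, -1, 0) ∉ S.lower) : ¬ A2IMinusClosed (S.dual h) :=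
  twoFactor_law h 1 (h - 1, 1, 0) (h - 1, -1, 0) S hD hP0 hN0 hP1 hX

/-- ANTIPODAL 2+2 ceiling-unit orbit (kit tag `antimix22`, census `P[((h−2)I+ℓ₋₁)² ∣ ((h−2)I+ℓ₁)²]`): head `[(h−2)I+ℓ₁ ∣ ((h−2)I+ℓ₋₁)² ∣ (h−2)I+ℓ₁]`,
server `[hI ∣ ((h−2)I+ℓ₋₁)² ∣ (h−4)I+2ℓ₁]`. -/
theorem antimix22_law (h : ℤ) (S : MConfig) (hD : S.InDiamond h) (hP0 : headT h 1 (h - 1, -1, 0) (h - 1, -1, 0) ∈ S.upper)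
    (hN0 : bLegT h 1 (h - 1, -1, 0) (h - 1, -1, 0) ∈ S.lower) (hP1 : serverT h 1 (h - 1, -1, 0) (h - 1, -1, 0) ∈ S.upper)
    (hX : serverT h 1 (h - 1, -1, 0) (h - 1, -1, 0) ∉ S.lower) : ¬ A2IMinusClosed (S.dual h) :=
  twoFactor_law h 1 (h - 1, -1, 0) (h - 1, -1, 0) S hD hP0 hN0 hP1 hX

/-- the cells of the `+i` odd instance at `h = 10`, letter by letter (`(9,1,0) = 8I+ℓ₁`, `(9,0,1) = 8I+ℓ₋ᵢ`, `(10,0,0) = 10I`, `(8,2,0) = 6I+2ℓ₁`). -/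
theorem oddPlusI_cells_10 :
    headT 10 1 (10 - 1, 1, 0) (10 - 1, 0, 1) = mcellOf (9, 1, 0) (9, 1, 0) (9, 0, 1) (9, 1, 0) ∧
    bLegT 10 1 (10 - 1, 1, 0) (10 - 1, 0, 1) = mcellOf (10, 0, 0) (9, 1, 0) (9, 0, 1) (9, 1, 0) ∧
    serverT 10 1 (10 - 1, 1, 0) (10 - 1, 0, 1) = mcellOf (10, 0, 0) (9, 1, 0) (9, 0, 1) (8, 2, 0) := by
  refine ⟨?_, ?_, ?_⟩ <;> funext f <;> fin_cases f <;> simp [headT, bLegT, serverT, mcellOf]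

/-- **THE ODD CEILING UNITS ARE EXCLUDED BY THE CHAIN (both chiralities, every height).** On an A♭_h-static ◇_h-support in which the odd head forces
its factor-0 b-leg and that b-leg forces the server, and the server's N-copy is absent, the odd head is absent. At `h = 10` the three displayed
hypotheses are, respectively, RULE D at the head (unit DP menu), the H₁^{G₁}-peel (78 of the 79 DN-menu cells refuted; kit j318002) and the peel
again (N-copy refuted, round 24) — so, modulo the soundness of A♭₁₀ as a necessary condition (LEMMA A∪2I♭, pencil ×1; Binder 1 ∕ A11 OPEN) and the
instrument (×1), «H₁-peel ⊕ A♭₁₀ refutes both odd ceiling-unit orbits by unit propagation», where H₁ alone needs search (kit j322459 STAGE B). -/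
theorem oddUnits_excluded_of_chain (h : ℤ) (S : MConfig) (hD : S.InDiamond h) (hcl : A2IMinusClosed (S.dual h)) (e : ℤ) (he : e = 1 ∨ e = -1)
    (hDP : headT h 1 (h - 1, 1, 0) (h - 1, 0, e) ∈ S.upper → bLegT h 1 (h - 1, 1, 0) (h - 1, 0, e) ∈ S.lower)
    (hDN : bLegT h 1 (h - 1, 1, 0) (h - 1, 0, e) ∈ S.lower → serverT h 1 (h - 1, 1, 0) (h - 1, 0, e) ∈ S.upper)
    (hX : serverT h 1 (h - 1, 1, 0) (h - 1, 0, e) ∉ S.lower) : headT h 1 (h - 1, 1, 0) (h - 1, 0, e) ∉ S.upper := by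
  rcases he with rfl | rfl <;> exact head_excluded_of_chain h 1 _ _ S hD hcl hDP hDN hX


end UnitLaw

end AnomalyLens

end Summit.Ventures.HSemireg.Pad4Tower
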